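import Literature.NumberTheory.Sieve.ParityWave0GreenTaoHolds
import HarnessLib

/-!
# Green–Tao (2008), Theorem 3.5 — Szemerédi's theorem relative to a pseudorandom measure (discharged)

Trunk T-SIEVE (`Literature/NumberTheory/Sieve`). B. Green, T. Tao, *The primes contain arbitrarily
long arithmetic progressions*, Ann. of Math. (2) 167 (2008), 481–547, **Theorem 3.5** (p. 492):
for `k ≥ 3` and `0 < δ ≤ 1` there is `c(k, δ) > 0` such that for every `k`-pseudorandom measure
`ν` (Def. 3.3) and every `f : ℤ_N → ℝ` with `0 ≤ f ≤ ν`, `E(f) ≥ δ`, one has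
`E(f(x) f(x+r) ⋯ f(x+(k-1)r) | x, r ∈ ℤ_N) ≥ c(k, δ) - o_{k,δ}(1)`. This is the named fact
`Literature.NumberTheory.Sieve.GreenTao2008.RelativeSzemeredi` of `GreenTao2008.lean`; this file
DISCHARGES it: `GreenTao2008.RelativeSzemeredi_holds`.

Green–Tao prove Theorem 3.5 in §§4–8 (Gowers uniformity norms and the generalised von Neumann
theorem, Prop. 5.3; dual functions, §6; σ-algebras generated by basic Gowers anti-uniform
functions, §7; the energy-increment decomposition, Prop. 8.1) from Szemerédi's theorem in the form
of their Prop. 2.3 ("in this paper, we must assume Szemerédi's theorem", p. 484). The tree reaches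
Theorem 3.5 along the Conlon–Fox–Zhao route instead, every link of which is already proved in the
tree; this file only composes them:

* `GreenTao2008.RelativeSzemeredi_of_cfz` (`GreenTao2008RelativeSzemeredi.lean`): Green–Tao's
  `(k 2^{k-1}, 3k-4, k)`-linear forms condition (Defs. 3.1, 3.3) implies Conlon–Fox–Zhao's
  `k`-linear forms condition (CFZ Def. 4.2), so Theorem 3.5 follows word for word from CFZ
  Thm. 4.3, the named fact `Literature.Combinatorics.Additive.CFZ.RelativeSzemeredi` (the
  correlation condition, Def. 3.2, is not used on this route);
* `CFZ.relativeSzemeredi_of` (`Combinatorics/Additive/RelativeSzemerediProofs.lean`): CFZ §7 —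
  Thm. 4.3 from the weighted Szemerédi theorem (CFZ Thm. 4.1 = Green–Tao Prop. 2.3, the named fact
  `GreenTao2008.SzemerediExpectation`), the dense model theorem (CFZ Thm. 5.1,
  `CFZ.denseModel_holds`) and the relative counting lemma (CFZ Thm. 6.5,
  `CFZ.relativeCounting_holds`);
* `GreenTao2008.SzemerediExpectation_holds` (`ParityWave0GreenTaoHolds.lean`): Prop. 2.3 from
  Szemerédi's theorem (`Literature.Combinatorics.Additive.SzemerediTheorem_holds`, obtained from
  the density Hales–Jewett theorem along Dodos–Kanellopoulos–Tyros) by Varnavides' argument.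

Placement: `GreenTao2008.lean` cannot host the discharge (the Conlon–Fox–Zhao files import it) and
neither can `GreenTao2008Proofs.lean` (imported by `GreenTao2008RelativeSzemeredi.lean`); hence
this sibling, which imports the leaf `ParityWave0GreenTaoHolds.lean` (itself importing, through
`GreenTaoFromSzemeredi` and the smooth-majorant files, all of the above).

Not here: Green–Tao's own §§4–8 argument (Props. 5.3, 6.2, 7.2–7.3, 8.1–8.2) is not formalised;
the constant obtained is the `c(k, δ/2)` of Prop. 2.3 (CFZ §7 applies Thm. 4.1 at density
`δ - o(1)`), which the existential `c` of the vendored statement permits.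

## References
* B. Green, T. Tao, *The primes contain arbitrarily long arithmetic progressions*, Ann. of
  Math. (2) 167 (2008), 481–547, doi:10.4007/annals.2008.167.481: Thm. 3.5 (p. 492), Prop. 2.3
  (p. 485), Defs. 3.1–3.3 (pp. 489–491), §§4–8 (pp. 492–522). [cite: GreenTaoAnnals2008]
* D. Conlon, J. Fox, Y. Zhao, *The Green–Tao theorem: an exposition*, EMS Surv. Math. Sci. 1
  (2014), 249–282: Def. 4.2, Thm. 4.3, §7. [cite: ConlonFoxZhao2014]
-/

namespace Literature.NumberTheory.Sieve.GreenTao2008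

/-- **Green–Tao 2008, Theorem 3.5 (Szemerédi's theorem relative to a pseudorandom measure) —
DISCHARGED.** The named fact `RelativeSzemeredi` holds: for `k ≥ 3`, `0 < δ ≤ 1` there is `c > 0`
such that for every `k`-pseudorandom family `ν = (ν_N)` and every `η > 0`, for all sufficiently
large primes `N`, every `f : ℤ_N → ℝ` with `0 ≤ f ≤ ν_N` and `𝔼 f ≥ δ` satisfies
`𝔼_{x,r ∈ ℤ_N} f(x) f(x+r) ⋯ f(x+(k-1)r) ≥ c - η`. Proof: Conlon–Fox–Zhao's relative Szemerédi
theorem (CFZ Thm. 4.3, proved in the tree from Green–Tao's Prop. 2.3, the dense model theorem and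
the relative counting lemma: `CFZ.relativeSzemeredi_of`, `CFZ.denseModel_holds`,
`CFZ.relativeCounting_holds`, `SzemerediExpectation_holds`) together with the comparison of the
linear forms conditions `RelativeSzemeredi_of_cfz`.
[cite: GreenTaoAnnals2008, Theorem 3.5] -/
theorem RelativeSzemeredi_holds : RelativeSzemeredi :=
  RelativeSzemeredi_of_cfz
    (Literature.Combinatorics.Additive.CFZ.relativeSzemeredi_of SzemerediExpectation_holds
      Literature.Combinatorics.Additive.CFZ.denseModel_holds
      Literature.Combinatorics.Additive.CFZ.relativeCounting_holds)

end Literature.NumberTheory.Sieve.GreenTao2008
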